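import Summits.CriticalPhenomena.PercolationContinuityZ3.Theses.PercHyperscalingGluing
import Summits.CriticalPhenomena.PercolationContinuityZ3.Theorems.PercHyperscalingGluingFewClustersGlueTools
import Literature.Probability.Percolation.SharpnessDCTProofs
import Literature.Probability.Percolation.LatticeSymmetry
import Literature.Probability.Percolation.RSW
import HarnessLib

/-!
# Route `PercHyperscalingGluing`, support item `FewClustersGlue` (stmt-CriticalPhenomena-4646)

`theorem fewClustersGlue_proof : …Theses.PercHyperscalingGluing.FewClustersGlue`, i.e.
`ArmsInFewClusters → BoxGluing` (both Props inlined in the route decl).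

## The argument (elementary; planner docstring of the item)

Fix `n ≥ 1`, write `Λ_m = box 3 m`, `A_x = DCT16.armEvent x n`, `C_{xy} = {x ↔ y in Λ_{Kn}}`,
`Few` = "every family of armed sites of `Λ_n`, pairwise not joined inside `Λ_{Kn}`, has at most `N0`
members", `S(ω) = #{x ∈ Λ_n : ω ∈ A_x}`, `π_n = P(0 ↔ ∂Λ_n)`.

* Tools file (`PercHyperscalingGluingFewClustersGlueTools.lean`): on `Few`,
  `S² ≤ N0 Σ_{x,y ∈ Λ_n} 1_{C_{xy}}` (equivalence classes + Cauchy–Schwarz), hence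
  `(Σ_x P(A_x ∩ Few))² ≤ N0 Σ_{x,y ∈ Λ_n} P(C_{xy})` (variance `≥ 0`).
* Translation invariance (`measureReal_openConnIn_le_shift`, `sum_measureReal_openConnIn_le`):
  `P(x ↔ y in Λ_{Kn}) ≤ P(0 ↔ y - x in Λ_{Kn+n})` for `x ∈ Λ_n` (`Λ_{Kn} - x ⊆ Λ_{Kn+n}`,
  `bondPercolation_real_preimage_shift`), and `y - x ∈ Λ_{2n}`, so
  `Σ_{x,y ∈ Λ_n} P(C_{xy}) ≤ |Λ_n| Σ_{z ∈ Λ_{2n}} P(0 ↔ z in Λ_{(K+1)n})`.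
* With `P(A_x) = π_n` (`DCT16.real_armEvent`) and the hypothesis `c Σ_x P(A_x) ≤ Σ_x P(A_x ∩ Few)`:
  `π_n² ≤ (N0/c²) |Λ_n|⁻¹ Σ_{z ∈ Λ_{2n}} P(0 ↔ z in Λ_{(K+1)n})` (`key`).
* Scales: for `m ≥ 2` put `n = ⌊m/2⌋`; `π_m ≤ π_n` (`DCT16.real_siteToBoundary_antitone`),
  `|Λ_m| ≤ 27 |Λ_n|`, `Λ_{2n} ⊆ Λ_m`, `Λ_{(K+1)n} ⊆ Λ_{Km}` (`two_scales`); for `m = 1` the `z = 0`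
  term alone gives the bound since `C ≥ 27 = |Λ_1|` (`scale_one`). Constants:
  `C = 27 (N0 / c² + 1)`, same `K`.

Pure proof file, no definitions.
-/

noncomputable section

namespace Summit.CriticalPhenomena.PercolationContinuityZ3.Theorems

open MeasureTheory ProbabilityTheory
open Literature.Probability.Percolation Literature.Probability.LatticeModels

/-! ## Translation invariance -/

/-- **Shift bound.** For `x ∈ Λ_n`: `P_p(x ↔ y in Λ_m) ≤ P_p(0 ↔ y - x in Λ_{m+n})`, by the
translation `· - x` (`Λ_m - x ⊆ Λ_{m+n}`) and the translation invariance of `P_p`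
(Grimmett 1999, §1.6). [folklore] -/
theorem FewClustersGlue.measureReal_openConnIn_le_shift {d : ℕ} (p : unitInterval) {n m : ℕ}
    {x : Site d} (hx : x ∈ box d n) (y : Site d) :
    (bondPercolation (zdGraph d) p).real (openConnIn (↑(box d m) : Set (Site d)) x y) ≤
      (bondPercolation (zdGraph d) p).real
        (openConnIn (↑(box d (m + n)) : Set (Site d)) 0 (y - x)) := by
  rw [← bondPercolation_real_preimage_shift (-x) p
    (openConnIn (↑(box d (m + n)) : Set (Site d)) 0 (y - x))]
  refine measureReal_mono (fun ω hω => ?_) (measure_ne_top _ _)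
  rw [Set.mem_preimage]
  have h := relabel_mem_openConnIn (Site.shift (-x)) hω
  rw [Site.shift_apply, Site.shift_apply, add_neg_cancel, ← sub_eq_add_neg] at h
  refine openConnIn_mono ?_ _ _ h
  rintro w ⟨z, hz, rfl⟩
  have hz' : z ∈ box d m := by simpa using hz
  rw [mem_box] at hz' hx
  simp only [Finset.mem_coe, mem_box, Site.shift_apply, Pi.add_apply, Pi.neg_apply]
  intro i
  have h1 := hz' i
  have h2 := hx i
  omega

/-- **Averaging the shift bound.** For `x ∈ Λ_n`:
`Σ_{y ∈ Λ_n} P_p(x ↔ y in Λ_m) ≤ Σ_{z ∈ Λ_{2n}} P_p(0 ↔ z in Λ_{m+n})` (reindex `z = y - x ∈ Λ_{2n}`).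
[folklore] -/
theorem FewClustersGlue.sum_measureReal_openConnIn_le {d : ℕ} (p : unitInterval) (n m : ℕ)
    {x : Site d} (hx : x ∈ box d n) :
    ∑ y ∈ box d n, (bondPercolation (zdGraph d) p).real
        (openConnIn (↑(box d m) : Set (Site d)) x y) ≤
      ∑ z ∈ box d (2 * n), (bondPercolation (zdGraph d) p).real
        (openConnIn (↑(box d (m + n)) : Set (Site d)) 0 z) := by
  classical
  have himage : (box d n).image (fun y => y - x) ⊆ box d (2 * n) := by
    intro z hz
    obtain ⟨y, hy, rfl⟩ := Finset.mem_image.1 hz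
    rw [mem_box] at hy hx ⊢
    intro i
    have h1 := hy i
    have h2 := hx i
    simp only [Pi.sub_apply]
    push_cast
    omega
  calc ∑ y ∈ box d n, (bondPercolation (zdGraph d) p).real
          (openConnIn (↑(box d m) : Set (Site d)) x y)
      ≤ ∑ y ∈ box d n, (bondPercolation (zdGraph d) p).real
          (openConnIn (↑(box d (m + n)) : Set (Site d)) 0 (y - x)) :=
        Finset.sum_le_sum fun y _ => FewClustersGlue.measureReal_openConnIn_le_shift p hx y
    _ = ∑ z ∈ (box d n).image (fun y => y - x), (bondPercolation (zdGraph d) p).real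
          (openConnIn (↑(box d (m + n)) : Set (Site d)) 0 z) := by
        rw [Finset.sum_image fun y _ y' _ h => sub_left_injective h]
    _ ≤ ∑ z ∈ box d (2 * n), (bondPercolation (zdGraph d) p).real
          (openConnIn (↑(box d (m + n)) : Set (Site d)) 0 z) :=
        Finset.sum_le_sum_of_subset_of_nonneg himage fun _ _ _ => measureReal_nonneg

/-! ## The one-scale inequality -/

/-- **One-scale gluing inequality.** Under the arm-tightness hypothesis at scale `n ≥ 1` with
constants `N0, K ≥ 1, c > 0`:
`π_n² ≤ (N0 / c²) |Λ_n|⁻¹ Σ_{z ∈ Λ_{2n}} P(0 ↔ z in Λ_{Kn+n})`. [folklore] -/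
theorem FewClustersGlue.key {d : ℕ} (p : unitInterval) (N0 K n : ℕ) (c : ℝ) (hc : 0 < c)
    (hK : 1 ≤ K)
    (hyp : c * ∑ x ∈ box d n, (bondPercolation (zdGraph d) p).real (DCT16.armEvent x n) ≤
      ∑ x ∈ box d n, (bondPercolation (zdGraph d) p).real (DCT16.armEvent x n ∩
        {ω | ∀ F : Finset (Site d), F ⊆ box d n → (∀ y ∈ F, ω ∈ DCT16.armEvent y n) →
          (↑F : Set (Site d)).Pairwise (fun y z => ω ∉ openConnIn ↑(box d (K * n)) y z) →
          F.card ≤ N0})) :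
    (bondPercolation (zdGraph d) p).real (siteToBoundary d n) ^ 2 ≤
      (N0 / c ^ 2) * ((box d n).card : ℝ)⁻¹ *
        ∑ z ∈ box d (2 * n), (bondPercolation (zdGraph d) p).real
          (openConnIn (↑(box d (K * n + n)) : Set (Site d)) 0 z) := by
  set μ := bondPercolation (zdGraph d) p with hμ
  set L : ℝ := ((box d n).card : ℝ) with hL
  set π : ℝ := μ.real (siteToBoundary d n) with hπ
  set T2 : ℝ := ∑ z ∈ box d (2 * n), μ.real
    (openConnIn (↑(box d (K * n + n)) : Set (Site d)) 0 z) with hT2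
  have hLpos : 0 < L := by
    rw [hL]
    exact_mod_cast (box_nonempty d n).card_pos
  -- `Σ_x P(A_x) = |Λ_n| π_n`
  have harm : ∑ x ∈ box d n, μ.real (DCT16.armEvent x n) = L * π := by
    simp_rw [hμ, DCT16.real_armEvent]
    rw [Finset.sum_const, nsmul_eq_mul]
  -- second moment
  have h2 := FewClustersGlue.sq_sum_measureReal_inter_le μ (box d n)
    (fun x => DCT16.armEvent x n)
    (fun x y => openConnIn (↑(box d (K * n)) : Set (Site d)) x y)
    {ω | ∀ F : Finset (Site d), F ⊆ box d n → (∀ y ∈ F, ω ∈ DCT16.armEvent y n) →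
      (↑F : Set (Site d)).Pairwise (fun y z => ω ∉ openConnIn ↑(box d (K * n)) y z) →
      F.card ≤ N0}
    (fun x _ => FewClustersGlue.measurableSet_armEvent x n)
    (fun x _ y _ => DCT16.measurableSet_openConnIn _ x y)
    (FewClustersGlue.measurableSet_few N0 K n) N0
    (fun ω hω => FewClustersGlue.pointwise N0 K n hK ω (by simpa only [Set.mem_setOf_eq] using hω))
  -- translation invariance
  have h3 : ∑ x ∈ box d n, ∑ y ∈ box d n, μ.real
      (openConnIn (↑(box d (K * n)) : Set (Site d)) x y) ≤ L * T2 := by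
    calc ∑ x ∈ box d n, ∑ y ∈ box d n, μ.real
          (openConnIn (↑(box d (K * n)) : Set (Site d)) x y)
        ≤ ∑ x ∈ box d n, T2 :=
          Finset.sum_le_sum fun x hx => FewClustersGlue.sum_measureReal_openConnIn_le p n (K * n) hx
      _ = L * T2 := by rw [Finset.sum_const, nsmul_eq_mul]
  -- combine
  have h1 : (c * (L * π)) ^ 2 ≤ N0 * (L * T2) := by
    rw [← harm]
    have h0 : 0 ≤ c * ∑ x ∈ box d n, μ.real (DCT16.armEvent x n) :=
      mul_nonneg hc.le (Finset.sum_nonneg fun _ _ => measureReal_nonneg)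
    calc (c * ∑ x ∈ box d n, μ.real (DCT16.armEvent x n)) ^ 2
        ≤ (∑ x ∈ box d n, μ.real (DCT16.armEvent x n ∩
            {ω | ∀ F : Finset (Site d), F ⊆ box d n → (∀ y ∈ F, ω ∈ DCT16.armEvent y n) →
              (↑F : Set (Site d)).Pairwise
                (fun y z => ω ∉ openConnIn ↑(box d (K * n)) y z) → F.card ≤ N0})) ^ 2 :=
          pow_le_pow_left₀ h0 hyp 2
      _ ≤ N0 * ∑ x ∈ box d n, ∑ y ∈ box d n, μ.real
            (openConnIn (↑(box d (K * n)) : Set (Site d)) x y) := h2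
      _ ≤ N0 * (L * T2) := mul_le_mul_of_nonneg_left h3 (Nat.cast_nonneg N0)
  have hc2 : (0 : ℝ) < c ^ 2 := by positivity
  have hcne : c ≠ 0 := hc.ne'
  have hLne : L ≠ 0 := hLpos.ne'
  calc π ^ 2 = (c * (L * π)) ^ 2 / (c ^ 2 * L ^ 2) := by field_simp
    _ ≤ N0 * (L * T2) / (c ^ 2 * L ^ 2) := by gcongr
    _ = N0 / c ^ 2 * L⁻¹ * T2 := by field_simp

/-! ## Change of scale -/

/-- `Λ_{Kn+n} ⊆ Λ_{Km}` when `K ≥ 1` and `2n ≤ m`. [folklore] -/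
theorem FewClustersGlue.mul_add_le {K n m : ℕ} (hK : 1 ≤ K) (hnm : 2 * n ≤ m) :
    K * n + n ≤ K * m :=
  calc K * n + n ≤ K * n + K * n := Nat.add_le_add_left (Nat.le_mul_of_pos_left n hK) _
    _ = K * (2 * n) := by ring
    _ ≤ K * m := Nat.mul_le_mul_left K hnm

/-- `|Λ_m| ≤ 27 |Λ_n|` in `ℤ³` when `m ≤ 2n + 1` (then `2m + 1 ≤ 3(2n + 1)`). [folklore] -/
theorem FewClustersGlue.card_box_le {n m : ℕ} (hmn : m ≤ 2 * n + 1) :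
    ((box 3 m).card : ℝ) ≤ 27 * (box 3 n).card := by
  have hm : ((box 3 m).card : ℝ) = (2 * m + 1) ^ 3 := by rw [card_box]; push_cast; ring
  have hn : ((box 3 n).card : ℝ) = (2 * n + 1) ^ 3 := by rw [card_box]; push_cast; ring
  rw [hm, hn]
  have h1 : (2 * (m : ℝ) + 1) ≤ 3 * (2 * n + 1) := by
    have : (m : ℝ) ≤ 2 * n + 1 := by exact_mod_cast hmn
    linarith
  have h0 : (0 : ℝ) ≤ 2 * m + 1 := by positivity
  calc (2 * (m : ℝ) + 1) ^ 3 ≤ (3 * (2 * n + 1)) ^ 3 := pow_le_pow_left₀ h0 h1 3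
    _ = 27 * (2 * n + 1) ^ 3 := by ring

/-- **Two scales.** From the one-scale inequality at `n ≥ 1` (conclusion of `key`) to the
`BoxGluing` inequality at every `m ∈ {2n, 2n+1}` with constant `27 N0 / c²`: `π_m ≤ π_n`
(`DCT16.real_siteToBoundary_antitone`), `|Λ_n|⁻¹ ≤ 27 |Λ_m|⁻¹`, `Λ_{2n} ⊆ Λ_m` and
`Λ_{Kn+n} ⊆ Λ_{Km}` (monotonicity of `{0 ↔ z in S}` in `S`). [folklore] -/
theorem FewClustersGlue.two_scales (p : unitInterval) (N0 K n m : ℕ) (c : ℝ) (hc : 0 < c)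
    (hK : 1 ≤ K) (hnm : 2 * n ≤ m) (hmn : m ≤ 2 * n + 1)
    (hkey : (bondPercolation (zdGraph 3) p).real (siteToBoundary 3 n) ^ 2 ≤
      (N0 / c ^ 2) * ((box 3 n).card : ℝ)⁻¹ *
        ∑ z ∈ box 3 (2 * n), (bondPercolation (zdGraph 3) p).real
          (openConnIn (↑(box 3 (K * n + n)) : Set (Site 3)) 0 z)) :
    (bondPercolation (zdGraph 3) p).real (siteToBoundary 3 m) ^ 2 ≤
      (27 * (N0 / c ^ 2)) * ((box 3 m).card : ℝ)⁻¹ *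
        ∑ z ∈ box 3 m, (bondPercolation (zdGraph 3) p).real
          (openConnIn (↑(box 3 (K * m)) : Set (Site 3)) 0 z) := by
  have hNc : (0 : ℝ) ≤ N0 / c ^ 2 := by positivity
  -- `π_m ≤ π_n`
  have hanti : (bondPercolation (zdGraph 3) p).real (siteToBoundary 3 m) ≤
      (bondPercolation (zdGraph 3) p).real (siteToBoundary 3 n) :=
    DCT16.real_siteToBoundary_antitone p (by omega)
  -- `|Λ_n|⁻¹ ≤ 27 |Λ_m|⁻¹`
  have hLmpos : (0 : ℝ) < (box 3 m).card := by exact_mod_cast (box_nonempty 3 m).card_pos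
  have hinv : ((box 3 n).card : ℝ)⁻¹ ≤ 27 * ((box 3 m).card : ℝ)⁻¹ := by
    have h := inv_anti₀ (by positivity : (0 : ℝ) < (box 3 m).card / 27)
      (by linarith [FewClustersGlue.card_box_le hmn] : ((box 3 m).card : ℝ) / 27 ≤ (box 3 n).card)
    rwa [inv_div, div_eq_mul_inv] at h
  -- the sums
  have hKn : K * n + n ≤ K * m := FewClustersGlue.mul_add_le hK hnm
  have hsum : ∑ z ∈ box 3 (2 * n), (bondPercolation (zdGraph 3) p).real
        (openConnIn (↑(box 3 (K * n + n)) : Set (Site 3)) 0 z) ≤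
      ∑ z ∈ box 3 m, (bondPercolation (zdGraph 3) p).real
        (openConnIn (↑(box 3 (K * m)) : Set (Site 3)) 0 z) :=
    calc ∑ z ∈ box 3 (2 * n), (bondPercolation (zdGraph 3) p).real
          (openConnIn (↑(box 3 (K * n + n)) : Set (Site 3)) 0 z)
        ≤ ∑ z ∈ box 3 (2 * n), (bondPercolation (zdGraph 3) p).real
          (openConnIn (↑(box 3 (K * m)) : Set (Site 3)) 0 z) :=
          Finset.sum_le_sum fun z _ => measureReal_mono
            (openConnIn_mono (Finset.coe_subset.2 (box_mono 3 hKn)) _ _) (measure_ne_top _ _)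
      _ ≤ ∑ z ∈ box 3 m, (bondPercolation (zdGraph 3) p).real
          (openConnIn (↑(box 3 (K * m)) : Set (Site 3)) 0 z) :=
          Finset.sum_le_sum_of_subset_of_nonneg (box_mono 3 hnm) fun z _ _ => measureReal_nonneg
  have hT2nn : 0 ≤ ∑ z ∈ box 3 (2 * n), (bondPercolation (zdGraph 3) p).real
      (openConnIn (↑(box 3 (K * n + n)) : Set (Site 3)) 0 z) :=
    Finset.sum_nonneg fun z _ => measureReal_nonneg
  have hπnn : 0 ≤ (bondPercolation (zdGraph 3) p).real (siteToBoundary 3 m) := measureReal_nonneg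
  have hcoef : 0 ≤ (N0 / c ^ 2) * (27 * ((box 3 m).card : ℝ)⁻¹) :=
    mul_nonneg hNc (mul_nonneg (by norm_num) (inv_nonneg.2 hLmpos.le))
  calc (bondPercolation (zdGraph 3) p).real (siteToBoundary 3 m) ^ 2
      ≤ (bondPercolation (zdGraph 3) p).real (siteToBoundary 3 n) ^ 2 :=
        pow_le_pow_left₀ hπnn hanti 2
    _ ≤ (N0 / c ^ 2) * ((box 3 n).card : ℝ)⁻¹ *
        ∑ z ∈ box 3 (2 * n), (bondPercolation (zdGraph 3) p).real
          (openConnIn (↑(box 3 (K * n + n)) : Set (Site 3)) 0 z) := hkey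
    _ ≤ (N0 / c ^ 2) * (27 * ((box 3 m).card : ℝ)⁻¹) *
        ∑ z ∈ box 3 (2 * n), (bondPercolation (zdGraph 3) p).real
          (openConnIn (↑(box 3 (K * n + n)) : Set (Site 3)) 0 z) :=
        mul_le_mul_of_nonneg_right (mul_le_mul_of_nonneg_left hinv hNc) hT2nn
    _ ≤ (N0 / c ^ 2) * (27 * ((box 3 m).card : ℝ)⁻¹) *
        ∑ z ∈ box 3 m, (bondPercolation (zdGraph 3) p).real
          (openConnIn (↑(box 3 (K * m)) : Set (Site 3)) 0 z) :=
        mul_le_mul_of_nonneg_left hsum hcoef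
    _ = (27 * (N0 / c ^ 2)) * ((box 3 m).card : ℝ)⁻¹ *
        ∑ z ∈ box 3 m, (bondPercolation (zdGraph 3) p).real
          (openConnIn (↑(box 3 (K * m)) : Set (Site 3)) 0 z) := by ring

/-- **Scale one.** `π_1² ≤ 1 ≤ C |Λ_1|⁻¹ Σ_{z ∈ Λ_1} P(0 ↔ z in Λ_K)` for `C ≥ 27`: the `z = 0`
term is `P(0 ↔ 0 in Λ_K) = 1` and `|Λ_1| = 27`. [folklore] -/
theorem FewClustersGlue.scale_one (p : unitInterval) (K : ℕ) (C : ℝ) (hC : 27 ≤ C) :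
    (bondPercolation (zdGraph 3) p).real (siteToBoundary 3 1) ^ 2 ≤
      C * ((box 3 1).card : ℝ)⁻¹ *
        ∑ z ∈ box 3 1, (bondPercolation (zdGraph 3) p).real
          (openConnIn (↑(box 3 (K * 1)) : Set (Site 3)) 0 z) := by
  have hτnn : ∀ z : Site 3, 0 ≤ (bondPercolation (zdGraph 3) p).real
      (openConnIn (↑(box 3 (K * 1)) : Set (Site 3)) 0 z) := fun z => measureReal_nonneg
  have h0 : (bondPercolation (zdGraph 3) p).real
      (openConnIn (↑(box 3 (K * 1)) : Set (Site 3)) 0 0) = 1 := by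
    have : (openConnIn (↑(box 3 (K * 1)) : Set (Site 3)) (0 : Site 3) 0) = Set.univ :=
      Set.eq_univ_of_forall fun ω =>
        ⟨Finset.mem_coe.2 (zero_mem_box 3 _), Finset.mem_coe.2 (zero_mem_box 3 _),
          SimpleGraph.Reachable.refl _⟩
    rw [this, probReal_univ]
  have hsum : (1 : ℝ) ≤ ∑ z ∈ box 3 1, (bondPercolation (zdGraph 3) p).real
      (openConnIn (↑(box 3 (K * 1)) : Set (Site 3)) 0 z) := by
    rw [← h0]
    exact Finset.single_le_sum (fun z _ => hτnn z) (zero_mem_box 3 1)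
  have hcard1 : ((box 3 1).card : ℝ) = 27 := by rw [card_box]; norm_num
  have hπle1 : (bondPercolation (zdGraph 3) p).real (siteToBoundary 3 1) ≤ 1 := measureReal_le_one
  have hπnn : 0 ≤ (bondPercolation (zdGraph 3) p).real (siteToBoundary 3 1) := measureReal_nonneg
  have hC0 : 0 ≤ C := le_trans (by norm_num) hC
  have hcoef : (1 : ℝ) ≤ C * ((box 3 1).card : ℝ)⁻¹ := by
    rw [hcard1, ← div_eq_mul_inv, one_le_div (by norm_num : (0 : ℝ) < 27)]
    exact hC
  calc (bondPercolation (zdGraph 3) p).real (siteToBoundary 3 1) ^ 2 ≤ 1 := pow_le_one₀ hπnn hπle1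
    _ ≤ C * ((box 3 1).card : ℝ)⁻¹ := hcoef
    _ = C * ((box 3 1).card : ℝ)⁻¹ * 1 := (mul_one _).symm
    _ ≤ C * ((box 3 1).card : ℝ)⁻¹ *
        ∑ z ∈ box 3 1, (bondPercolation (zdGraph 3) p).real
          (openConnIn (↑(box 3 (K * 1)) : Set (Site 3)) 0 z) :=
        mul_le_mul_of_nonneg_left hsum (mul_nonneg hC0 (inv_nonneg.2 (by norm_num)))

/-! ## The support item -/

/-- **Support item `FewClustersGlue`** of route `PercHyperscalingGluing` (stmt-CriticalPhenomena-4646):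
`ArmsInFewClusters → BoxGluing`. From `ArmsInFewClusters` with constants `N0, K ≥ 2, c > 0` we get
`BoxGluing` with `C = 27 (N0 / c² + 1)` and the same `K`: for `m ≥ 2` apply the one-scale inequality
`key` at `n = ⌊m/2⌋` and change scale (`two_scales`); for `m = 1` use `scale_one`
(`C ≥ 27 = |Λ_1|`). [folklore] -/
theorem fewClustersGlue_proof :
    Summit.CriticalPhenomena.PercolationContinuityZ3.Theses.PercHyperscalingGluing.FewClustersGlue := by
  unfold Summit.CriticalPhenomena.PercolationContinuityZ3.Theses.PercHyperscalingGluing.FewClustersGlue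
  rintro ⟨N0, K, c, hc, hK, hyp⟩
  have hK1 : 1 ≤ K := le_trans (by norm_num) hK
  have hNc : (0 : ℝ) ≤ N0 / c ^ 2 := by positivity
  have hCpos : (0 : ℝ) < 27 * (N0 / c ^ 2 + 1) := by positivity
  have hC27 : (27 : ℝ) ≤ 27 * (N0 / c ^ 2 + 1) :=
    le_mul_of_one_le_right (by norm_num) (by linarith)
  have hCN : 27 * (N0 / c ^ 2) ≤ 27 * ((N0 : ℝ) / c ^ 2 + 1) :=
    mul_le_mul_of_nonneg_left (by linarith) (by norm_num)
  refine ⟨27 * (N0 / c ^ 2 + 1), K, hCpos, hK1, fun m hm => ?_⟩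
  rcases Nat.lt_or_ge m 2 with hm2 | hm2
  · -- `m = 1`
    obtain rfl : m = 1 := by omega
    exact FewClustersGlue.scale_one (criticalProbI 3) K _ hC27
  · -- `m ≥ 2`: halve the scale
    obtain ⟨n, hn1, hnm, hmn⟩ : ∃ n : ℕ, 1 ≤ n ∧ 2 * n ≤ m ∧ m ≤ 2 * n + 1 :=
      ⟨m / 2, by omega, by omega, by omega⟩
    have h := FewClustersGlue.two_scales (criticalProbI 3) N0 K n m c hc hK1 hnm hmn
      (FewClustersGlue.key (criticalProbI 3) N0 K n c hc hK1 (hyp n hn1))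
    refine h.trans ?_
    have hSnn : 0 ≤ ∑ z ∈ box 3 m, (bondPercolation (zdGraph 3) (criticalProbI 3)).real
        (openConnIn (↑(box 3 (K * m)) : Set (Site 3)) 0 z) :=
      Finset.sum_nonneg fun z _ => measureReal_nonneg
    have hLmpos : (0 : ℝ) < (box 3 m).card := by exact_mod_cast (box_nonempty 3 m).card_pos
    exact mul_le_mul_of_nonneg_right
      (mul_le_mul_of_nonneg_right hCN (inv_nonneg.2 hLmpos.le)) hSnn

end Summit.CriticalPhenomena.PercolationContinuityZ3.Theorems

end
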